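import Literature.AlgebraicGeometry.Motives.UniversalHypersurfaceRegularLocus
import Literature.AlgebraicGeometry.HodgeTheory.UniversalHypersurfaceEhresmann
import Literature.AlgebraicGeometry.HodgeTheory.HypersurfaceComplexPoints
import Literature.AlgebraicGeometry.Motives.UniversalHypersurfaceBaseChart
import HarnessLib

/-!
# Coordinates on the regular locus `𝒴°` of the universal hypersurface: coefficients and homogeneous coordinates

Family `hodge`, layer `Literature/AlgebraicGeometry/Motives`; sequel of `UniversalHypersurfaceRegularLocus`
(`regularLocus`, `regularTotal k n d = 𝒴°` as a `k`-scheme, `regularFamily : 𝒴° → S^d = Spec k[a_m]`,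
`totalToRegular : 𝒴_U ↪ 𝒴°`). Written by the prover seat `hodge-nonav-prover-Ax` (g10) for the programme
discharging the nodal-meridian local monodromy fact (`HodgeTheory/CyclicCoverNodalMeridianLocalMonodromyBound`,
crux K1 of `Summits/HodgeConjecture/HodgeConjecture/Theses/CyclicUnitaryPowers.lean`): the differential topology of
the degeneration to a nodal member is done on the complex manifold `𝒴°(ℂ)` (`Motives/ComplexPointsManifold`),
and this file provides its REGULAR COORDINATES — the point of `𝒴° ⊆ ℙⁿ⁺¹ × S^d` with coefficient vector
`b = (b_m)` and homogeneous coordinates `[z]`: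

* §1 `regularToProjectiveSpace k n d : 𝒴° ⟶ ℙⁿ⁺¹_k` — the projection (`𝒴° ↪ 𝒴 ↪ ℙⁿ⁺¹_R → ℙⁿ⁺¹_k`), with
  `totalToRegular ≫ regularToProjectiveSpace = toProjectiveSpace` (the projection of `UniversalHypersurfaceEhresmann`);
* §2 `regPointHom Q : R → K`, `regCoeff Q : DegIndex n d → K`, `regForm Q = Σ_m b_m(Q) x^m` — the coefficient
  homomorphism / vector / form of a `K`-point `Q` of `𝒴°` (as `pointHom`, `coeffVector`, `pointForm` of
  `UniversalHypersurfaceFamily` / `UniversalHypersurfaceBaseChart` for points of `U`), compatible with `totalToRegular`;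
* §3 **a point of `𝒴°` is determined by its coefficients and its image in `ℙⁿ⁺¹`** (`eq_of_map_eq_of_regCoeff_eq`;
  `ℙⁿ⁺¹_R = ℙⁿ⁺¹_k ×_k S^d`, `ProjBaseChangeRing.isPullback_projMap'`, and `regularTotalι : 𝒴° ↪ 𝒴 ↪ ℙⁿ⁺¹_R` is a monomorphism);
  over `ℂ`: `eq_of_hypersurfacePoint_eq_of_regCoeff_eq` for the homogeneous-coordinate map
  `hypersurfacePoint (regularToProjectiveSpace ℂ n d) : 𝒴°(ℂ) → ℙ(ℂⁿ⁺²)` of `HodgeTheory/HypersurfaceComplexPoints`;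
* §4 **the coefficients are regular functions**: `regCoeff Q m` is the value at `Q` of the global function
  `regCoeffFn m = π^*(a_m)` (`regCoeff_eq_evalOrZero`), so that it is continuous (and `C^∞` on `𝒴°(ℂ)`,
  `Motives/ComplexPointsRegularFunctionSmooth`); the affine coordinates `z_k/z_i` are the values of the regular
  functions `ι^*(x_k/x_i)` on `ι⁻¹(D₊(x_i))` (`evalOrZero_regCoordFn`, the general-`ι` form of
  `HodgeTheory.evalOrZero_hypersurfaceCoordFn`).

Everything is proved; the definitions are the concrete ones listed; no named facts. The EQUATION
`Σ_m b_m(Q) z^m = 0` is the sequel `UniversalHypersurfaceRegularLocusEquation`.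

## References

* [VoisinHodgeII2003] C. Voisin, Hodge Theory and Complex Algebraic Geometry II (2003), §6.2.1.
* [SerreGAGA1956] J.-P. Serre, Géométrie algébrique et géométrie analytique, Ann. Inst. Fourier 6 (1956), §2 n°5.
* [Hartshorne1977] R. Hartshorne, Algebraic Geometry (1977), II Ex. 2.7, II.3 (fibre products), II Thm. 7.1.
-/

noncomputable section

open CategoryTheory CategoryTheory.Limits AlgebraicGeometry MvPolynomial TopologicalSpace

universe u

namespace Literature.AlgebraicGeometry.Motives.UniversalHypersurface

attribute [local instance] MvPolynomial.gradedAlgebra ProjBaseChange.algebraBase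
  ProjBaseChange.isScalarTower_localization

/-! ### §1 The projection `𝒴° → ℙⁿ⁺¹_k` -/

section Scheme

variable (k : Type u) [Field k] (n d : ℕ)

/-- `𝒴° ↪ 𝒴 ↪ ℙⁿ⁺¹_R`, typed as a morphism out of the underlying scheme `(regularTotal k n d).left` of the
`k`-scheme `𝒴°` (so that compositions with points `Spec K → 𝒴°` are syntactically well typed).
[cite: VoisinHodgeII2003, §6.2.1] -/
def regularTotalι : (regularTotal k n d).left ⟶ projSp n (CoeffRing k n d) :=
  (regularLocus k n d).ι ≫ totalι k n d

/-- `𝒴° ↪ ℙⁿ⁺¹_R` is a monomorphism (open immersion followed by closed immersion).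
[cite: Hartshorne1977, II Ex. 3.11 and II.4 (immersions are monomorphisms)] -/
theorem mono_regularTotalι : Mono (regularTotalι k n d) := by
  have h : Mono ((regularLocus k n d).ι ≫ totalι k n d) := mono_comp _ _
  exact h

/-- The image of `𝒴° ↪ ℙⁿ⁺¹_R` lies in `V₊(F)` (`range_totalι`). [cite: VoisinHodgeII2003, §6.2.1] -/
theorem range_regularTotalι_subset :
    Set.range (regularTotalι k n d).base ⊆
      ProjectiveSpectrum.zeroLocus (MvPolynomial.homogeneousSubmodule (Fin (n + 2)) (CoeffRing k n d))
        {universalForm k n d} := by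
  rintro _ ⟨y, rfl⟩
  change (totalι k n d).base ((regularLocus k n d).ι.base y) ∈ _
  rw [← range_totalι]
  exact Set.mem_range_self _

/-- `𝒴° → S^d`, typed out of `(regularTotal k n d).left`: the term `regularToSpec` (`= (regularFamily k n d).left`).
[cite: VoisinHodgeII2003, §6.2.1] -/
def regularToSpec' : (regularTotal k n d).left ⟶ Spec (.of (CoeffRing k n d)) :=
  (regularLocus k n d).ι ≫ totalToSpec k n d

/-- `(regularFamily k n d).left = regularToSpec'` (`rfl`). [cite: VoisinHodgeII2003, §6.2.1] -/
theorem regularFamily_left_eq : (regularFamily k n d).left = regularToSpec' k n d := rfl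

/-- `regularToSpec' = regularTotalι ≫ (ℙⁿ⁺¹_R → S^d)`. [cite: VoisinHodgeII2003, §6.2.1] -/
theorem regularToSpec'_eq : regularToSpec' k n d = regularTotalι k n d ≫ projSpToSpec n (CoeffRing k n d) :=
  (Category.assoc _ _ _).symm

/-- **The projection `𝒴° ⊆ ℙⁿ⁺¹_k × S^d → ℙⁿ⁺¹_k`** as a morphism of `k`-schemes: `𝒴° ↪ 𝒴 ↪ ℙⁿ⁺¹_R → ℙⁿ⁺¹_k`
(`R = k[a_m]`; the last map is the base change `HodgeTheory.UniversalHypersurface.projSpToProjSp`).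
[cite: VoisinHodgeII2003, §6.2.1] -/
def regularToProjectiveSpace : regularTotal k n d ⟶ Motives.projectiveSpace (n + 1) k :=
  Over.homMk (regularTotalι k n d ≫ HodgeTheory.UniversalHypersurface.projSpToProjSp k n d) (by
    change (regularTotalι k n d ≫ HodgeTheory.UniversalHypersurface.projSpToProjSp k n d) ≫ projSpToSpec n k =
      regularToSpec' k n d ≫ specCoeffToSpec k n d
    rw [regularToSpec'_eq]
    simp only [Category.assoc, HodgeTheory.UniversalHypersurface.projSpToProjSp_comp_projSpToSpec])

/-- The underlying scheme morphism of `regularToProjectiveSpace` (`rfl`). [cite: VoisinHodgeII2003, §6.2.1] -/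
theorem regularToProjectiveSpace_left :
    (regularToProjectiveSpace k n d).left =
      regularTotalι k n d ≫ HodgeTheory.UniversalHypersurface.projSpToProjSp k n d :=
  rfl

/-- `totalToRegular.left ≫ (𝒴° ↪ ℙⁿ⁺¹_R) = (𝒴_U ⊆ 𝒴).ι ≫ (𝒴 ↪ ℙⁿ⁺¹_R)`. [cite: VoisinHodgeII2003, §6.2.1] -/
theorem totalToRegular_left_comp_ι :
    (totalToRegular k n d).left ≫ regularTotalι k n d =
      ((totalToSpec k n d) ⁻¹ᵁ (baseOpens k n d)).ι ≫ totalι k n d := by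
  change Scheme.homOfLE (totalSpace k n d) (preimage_baseOpens_le_regularLocus k n d) ≫
    (regularLocus k n d).ι ≫ totalι k n d = _
  rw [← Category.assoc, Scheme.homOfLE_ι]

/-- **Compatibility with the projection of the smooth family**: `totalToRegular ≫ regularToProjectiveSpace =
toProjectiveSpace`. [cite: VoisinHodgeII2003, §6.2.1] -/
theorem totalToRegular_comp_regularToProjectiveSpace :
    totalToRegular k n d ≫ regularToProjectiveSpace k n d =
      HodgeTheory.UniversalHypersurface.toProjectiveSpace k n d := by
  ext : 1
  change (totalToRegular k n d).left ≫ regularTotalι k n d ≫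
      HodgeTheory.UniversalHypersurface.projSpToProjSp k n d =
    ((totalToSpec k n d) ⁻¹ᵁ (baseOpens k n d)).ι ≫ totalι k n d ≫
      HodgeTheory.UniversalHypersurface.projSpToProjSp k n d
  rw [reassoc_of% (totalToRegular_left_comp_ι k n d)]
  exact Category.assoc _ _ _

end Scheme

/-! ### §2 The coefficient homomorphism, vector and form of a point of `𝒴°` -/

section Points

variable (k : Type u) [Field k] (n d : ℕ) {K : Type u} [Field K] [Algebra k K]

/-- The **coefficient homomorphism** `R → K` of a `K`-point `Q` of `𝒴°`: `Spec` of it is `Q ≫ (𝒴° → S^d)`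
(Mathlib `Spec.preimage`; as `pointHom` for points of `U`). [cite: VoisinHodgeII2003, §6.2.1] -/
def regPointHom (Q : AlgPoints (regularTotal k n d) K) : CommRingCat.of (CoeffRing k n d) ⟶ CommRingCat.of K :=
  Spec.preimage (Q.toSpecHom ≫ regularToSpec' k n d)

/-- `Spec (regPointHom Q) = Q ≫ (𝒴° → S^d)`. [cite: VoisinHodgeII2003, §6.2.1] -/
theorem Spec_map_regPointHom (Q : AlgPoints (regularTotal k n d) K) :
    Spec.map (regPointHom k n d Q) = Q.toSpecHom ≫ regularToSpec' k n d :=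
  Spec.map_preimage _

/-- The coefficient homomorphism restricts to the structure map on `k` (`Q` is a `k`-morphism).
[cite: VoisinHodgeII2003, §6.2.1] -/
theorem regPointHom_comp_algebraMap (Q : AlgPoints (regularTotal k n d) K) :
    (regPointHom k n d Q).hom.comp (algebraMap k (CoeffRing k n d)) = algebraMap k K := by
  have hw : Spec.map (regPointHom k n d Q) ≫ specCoeffToSpec k n d = Spec.map (CommRingCat.ofHom (algebraMap k K)) := by
    rw [Spec_map_regPointHom, Category.assoc]
    exact Over.w Q
  rw [← Spec.map_comp] at hw
  have := congrArg CommRingCat.Hom.hom (Spec.map_injective hw)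
  simpa using this

/-- The **coefficient vector** `(b_m(Q))_m` of a `K`-point of `𝒴°`. [cite: VoisinHodgeII2003, §6.2.1] -/
def regCoeff (Q : AlgPoints (regularTotal k n d) K) : DegIndex n d → K :=
  fun m => (regPointHom k n d Q).hom (X m)

/-- The coefficient homomorphism is evaluation at the coefficient vector. [cite: VoisinHodgeII2003, §6.2.1] -/
theorem regPointHom_hom_eq_aeval (Q : AlgPoints (regularTotal k n d) K) :
    (regPointHom k n d Q).hom = (MvPolynomial.aeval (regCoeff k n d Q)).toRingHom := by
  refine MvPolynomial.ringHom_ext (fun r => ?_) fun m => ?_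
  · have hs := congrArg (fun φ : k →+* K => φ r) (regPointHom_comp_algebraMap k n d Q)
    simp only [RingHom.comp_apply] at hs
    rw [MvPolynomial.algebraMap_eq] at hs
    rw [hs, AlgHom.toRingHom_eq_coe, RingHom.coe_coe, MvPolynomial.algHom_C]
  · rw [AlgHom.toRingHom_eq_coe, RingHom.coe_coe, MvPolynomial.aeval_X]
    rfl

/-- The **form** `F_Q = Σ_m b_m(Q) x^m ∈ K[x₀, …, x_{n+1}]` of a `K`-point of `𝒴°` (the universal form specialised
along the coefficient homomorphism). [cite: VoisinHodgeII2003, §6.2.1] -/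
def regForm (Q : AlgPoints (regularTotal k n d) K) : MvPolynomial (Fin (n + 2)) K :=
  MvPolynomial.map (regPointHom k n d Q).hom (universalForm k n d)

/-- The form of a point is homogeneous of degree `d`. [cite: VoisinHodgeII2003, §6.2.1] -/
theorem isHomogeneous_regForm (Q : AlgPoints (regularTotal k n d) K) : (regForm k n d Q).IsHomogeneous d :=
  (isHomogeneous_universalForm k n d).map _

/-- `F_Q = formOfCoeffs (regCoeff Q)`. [cite: VoisinHodgeII2003, §6.2.1] -/
theorem regForm_eq_formOfCoeffs (Q : AlgPoints (regularTotal k n d) K) :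
    regForm k n d Q = formOfCoeffs (regCoeff k n d Q) := by
  rw [regForm, formOfCoeffs_def, universalForm]
  simp only [map_sum, map_monomial]
  rfl

end Points

/-! ### §2b Compatibility with the smooth family `𝒴_U ↪ 𝒴°` -/

section Compat

/- `coeffVector` (`UniversalHypersurfaceBaseChart`) pins `k` to universe `0`. -/
variable (k : Type) [Field k] (n d : ℕ) {K : Type} [Field K] [Algebra k K]

/-- **Compatibility with the smooth family**: the coefficient homomorphism of the image in `𝒴°` of a point `P` of
`𝒴_U` is the coefficient homomorphism of `π(P) ∈ U`. [cite: VoisinHodgeII2003, §6.2.1] -/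
theorem regPointHom_map_totalToRegular (P : AlgPoints (total k n d) K) :
    regPointHom k n d (AlgPoints.map (totalToRegular k n d) P) = pointHom k n d (AlgPoints.map (family k n d) P) := by
  apply Spec.map_injective
  rw [Spec_map_regPointHom, Spec_map_pointHom]
  change (P.toSpecHom ≫ (totalToRegular k n d).left) ≫ regularToSpec' k n d =
    (P.toSpecHom ≫ (family k n d).left) ≫ (baseOpens k n d).ι
  simp only [Category.assoc]
  congr 1
  exact congrArg CommaMorphism.left (totalToRegular_comp_regularFamily k n d)

/-- The coefficient vector of the image of `P ∈ 𝒴_U` is the coefficient vector of `π(P)`.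
[cite: VoisinHodgeII2003, §6.2.1] -/
theorem regCoeff_map_totalToRegular (P : AlgPoints (total k n d) K) :
    regCoeff k n d (AlgPoints.map (totalToRegular k n d) P) = coeffVector k n d (AlgPoints.map (family k n d) P) := by
  funext m
  rw [regCoeff, regPointHom_map_totalToRegular]
  rfl

/-- The form of the image of `P ∈ 𝒴_U` is the form `F_{π(P)}`. [cite: VoisinHodgeII2003, §6.2.1] -/
theorem regForm_map_totalToRegular (P : AlgPoints (total k n d) K) :
    regForm k n d (AlgPoints.map (totalToRegular k n d) P) = pointForm k n d (AlgPoints.map (family k n d) P) := by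
  rw [regForm, regPointHom_map_totalToRegular]
  rfl

end Compat

/-! ### §3 A point of `𝒴°` is determined by its coefficients and its image in `ℙⁿ⁺¹` -/

section Determined

variable (k : Type u) [Field k] (n d : ℕ) {K : Type u} [Field K] [Algebra k K]

/-- **A `K`-point of `𝒴°` is determined by its images in `ℙⁿ⁺¹_k` and in `S^d`**: `ℙⁿ⁺¹_R = ℙⁿ⁺¹_k ×_k S^d`
(`ProjBaseChangeRing.isPullback_projMap'`) and `𝒴° ↪ 𝒴 ↪ ℙⁿ⁺¹_R` is a monomorphism.
[cite: Hartshorne1977, II.3 (fibre products) and II Ex. 2.7] -/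
theorem eq_of_map_eq_of_map_regularFamily_eq {Q Q' : AlgPoints (regularTotal k n d) K}
    (h₁ : AlgPoints.map (regularToProjectiveSpace k n d) Q = AlgPoints.map (regularToProjectiveSpace k n d) Q')
    (h₂ : AlgPoints.map (regularFamily k n d) Q = AlgPoints.map (regularFamily k n d) Q') : Q = Q' := by
  have hsq := Motives.ProjBaseChangeRing.isPullback_projMap' k (CoeffRing k n d) (n := n + 1)
  have key : Q.toSpecHom ≫ regularTotalι k n d = Q'.toSpecHom ≫ regularTotalι k n d := by
    refine hsq.hom_ext ?_ ?_
    · change (Q.toSpecHom ≫ regularTotalι k n d) ≫ HodgeTheory.UniversalHypersurface.projSpToProjSp k n d =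
        (Q'.toSpecHom ≫ regularTotalι k n d) ≫ HodgeTheory.UniversalHypersurface.projSpToProjSp k n d
      simp only [Category.assoc]
      exact congrArg CommaMorphism.left h₁
    · change (Q.toSpecHom ≫ regularTotalι k n d) ≫ projSpToSpec n (CoeffRing k n d) =
        (Q'.toSpecHom ≫ regularTotalι k n d) ≫ projSpToSpec n (CoeffRing k n d)
      have e₂ : Q.toSpecHom ≫ regularToSpec' k n d = Q'.toSpecHom ≫ regularToSpec' k n d :=
        congrArg CommaMorphism.left h₂
      simp only [Category.assoc]
      simpa only [regularToSpec'_eq, Category.assoc] using e₂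
  haveI := mono_regularTotalι k n d
  exact Over.OverMorphism.ext ((cancel_mono (regularTotalι k n d)).mp key)

/-- A `K`-point of `𝒴°` is determined by its image in `ℙⁿ⁺¹_k` and its coefficient vector.
[cite: Hartshorne1977, II.3 and II Ex. 2.7] -/
theorem eq_of_map_eq_of_regCoeff_eq {Q Q' : AlgPoints (regularTotal k n d) K}
    (h₁ : AlgPoints.map (regularToProjectiveSpace k n d) Q = AlgPoints.map (regularToProjectiveSpace k n d) Q')
    (h₂ : regCoeff k n d Q = regCoeff k n d Q') : Q = Q' := by
  refine eq_of_map_eq_of_map_regularFamily_eq k n d h₁ ?_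
  have hφ : regPointHom k n d Q = regPointHom k n d Q' := by
    ext1
    rw [regPointHom_hom_eq_aeval, regPointHom_hom_eq_aeval, h₂]
  apply Over.OverMorphism.ext
  change Q.toSpecHom ≫ regularToSpec' k n d = Q'.toSpecHom ≫ regularToSpec' k n d
  rw [← Spec_map_regPointHom, ← Spec_map_regPointHom, hφ]

end Determined

/-! ### §3 (over `ℂ`) Homogeneous coordinates -/

section Complex

variable (n d : ℕ)

/-- **A complex point of `𝒴°` is determined by its homogeneous coordinates `[z] ∈ ℙ(ℂⁿ⁺²)` and its coefficient
vector `b ∈ ℂ^{DegIndex n d}`.** [cite: SerreGAGA1956, §2 n°5] [cite: Hartshorne1977, II.3] -/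
theorem eq_of_hypersurfacePoint_eq_of_regCoeff_eq {Q Q' : ComplexPoints (regularTotal ℂ n d)}
    (h₁ : HodgeTheory.hypersurfacePoint (regularToProjectiveSpace ℂ n d) Q =
      HodgeTheory.hypersurfacePoint (regularToProjectiveSpace ℂ n d) Q')
    (h₂ : regCoeff ℂ n d Q = regCoeff ℂ n d Q') : Q = Q' := by
  refine eq_of_map_eq_of_regCoeff_eq ℂ n d ?_ h₂
  rw [← HodgeTheory.projPoint_hypersurfacePoint, ← HodgeTheory.projPoint_hypersurfacePoint, h₁]

/-- The pair (coefficient vector, homogeneous coordinates) is injective on `𝒴°(ℂ)`.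
[cite: SerreGAGA1956, §2 n°5] -/
theorem injective_regCoeff_prod_hypersurfacePoint :
    Function.Injective fun Q : ComplexPoints (regularTotal ℂ n d) =>
      (regCoeff ℂ n d Q, HodgeTheory.hypersurfacePoint (regularToProjectiveSpace ℂ n d) Q) :=
  fun _ _ h => eq_of_hypersurfacePoint_eq_of_regCoeff_eq n d (congrArg Prod.snd h) (congrArg Prod.fst h)

/-- Homogeneous coordinates are compatible with `𝒴_U ↪ 𝒴°`. [cite: SerreGAGA1956, §2 n°5] -/
theorem hypersurfacePoint_map_totalToRegular (P : ComplexPoints (total ℂ n d)) :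
    HodgeTheory.hypersurfacePoint (regularToProjectiveSpace ℂ n d) (AlgPoints.map (totalToRegular ℂ n d) P) =
      HodgeTheory.hypersurfacePoint (HodgeTheory.UniversalHypersurface.toProjectiveSpace ℂ n d) P := by
  refine HodgeTheory.hypersurfacePoint_eq_of_projPoint_eq _ _ ?_
  rw [HodgeTheory.projPoint_hypersurfacePoint, ← AlgPoints.map_comp_apply,
    totalToRegular_comp_regularToProjectiveSpace]

end Complex

/-! ### §4 The coordinates are regular functions -/

section RegularFunctions

variable (k : Type u) [Field k] (n d : ℕ) {K : Type u} [Field K] [Algebra k K]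

/-- The **coefficient function** `b_m = π^*(a_m) ∈ Γ(𝒴°, 𝒪)`: the variable `a_m ∈ R = Γ(S^d, 𝒪)` pulled back along
`𝒴° → S^d`. [cite: VoisinHodgeII2003, §6.2.1] -/
def regCoeffFn (m : DegIndex n d) : Γ((regularTotal k n d).left, (regularFamily k n d).left ⁻¹ᵁ ⊤) :=
  (regularFamily k n d).left.app ⊤ ((Scheme.ΓSpecIso (.of (CoeffRing k n d))).inv (X m))

/-- The coefficient homomorphism of `Q` is the algebra map underlying the point `π(Q)` of `S^d = Spec R`
(`AlgPoints.toAlgHom`; both are `Spec.preimage` of `Q ≫ (𝒴° → S^d)`). [cite: Hartshorne1977, II Ex. 2.7] -/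
theorem regPointHom_hom_eq_toAlgHom (Q : AlgPoints (regularTotal k n d) K) :
    (regPointHom k n d Q).hom =
      (AlgPoints.toAlgHom (AlgPoints.map (regularFamily k n d) Q :
        AlgPoints (specOver k (CoeffRing k n d)) K)).toRingHom :=
  rfl

/-- **The coefficients are values of regular functions**: `b_m(Q) = (π^* a_m)(Q)`.
[cite: Hartshorne1977, II Ex. 2.7] [cite: VoisinHodgeII2003, §6.2.1] -/
theorem regCoeff_eq_evalOrZero (Q : AlgPoints (regularTotal k n d) K) (m : DegIndex n d) :
    regCoeff k n d Q m = AlgPoints.evalOrZero ((regularFamily k n d).left ⁻¹ᵁ ⊤) (regCoeffFn k n d m) Q := by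
  set P : AlgPoints (specOver k (CoeffRing k n d)) K := AlgPoints.map (regularFamily k n d) Q with hP
  have hPt : P.pt ∈ (⊤ : (Spec (.of (CoeffRing k n d))).Opens) := trivial
  have h1 : AlgPoints.evalOrZero ((regularFamily k n d).left ⁻¹ᵁ ⊤) (regCoeffFn k n d m) Q =
      AlgPoints.evalOrZero ⊤ ((Scheme.ΓSpecIso (.of (CoeffRing k n d))).inv (X m)) P := by
    rw [hP, AlgPoints.evalOrZero_map]
    rfl
  rw [h1, AlgPoints.evalOrZero_of_mem _ hPt]
  have h2 := AlgPoints.eval_ofAlgHom_top (AlgPoints.toAlgHom P)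
  rw [AlgPoints.ofAlgHom_toAlgHom] at h2
  rw [h2 hPt, Iso.inv_hom_id_apply]
  rfl

end RegularFunctions

end Literature.AlgebraicGeometry.Motives.UniversalHypersurface

/-! ### §4b Affine coordinates of a scheme mapping to `ℙⁿ⁺¹_ℂ` (general `ι`) -/

namespace Literature.AlgebraicGeometry.HodgeTheory

open Literature.NumberTheory.Transcendental Set

attribute [local instance] MvPolynomial.gradedAlgebra

variable {n : ℕ} {Y : Motives.SchemeOver ℂ} (ι : Y ⟶ Motives.projectiveSpace (n + 1) ℂ) (i : Fin (n + 2))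

/-- **The complex points of `ι⁻¹(D₊(Xᵢ))` are the preimage of the chart domain `Uᵢ`** (any `ι : Y ⟶ ℙⁿ⁺¹_ℂ`).
[cite: SerreGAGA1956, §2 n°5 Prop. 2] -/
theorem setOf_pt_mem_preimage_projChartOpen :
    {P : Motives.ComplexPoints Y | P.pt ∈ ι.left ⁻¹ᵁ projChartOpen i} =
      hypersurfacePoint ι ⁻¹' (Projectivization.stdChart i).source :=
  Set.ext fun P => pt_map_mem_projChartOpen_iff ι i P

/-- **The affine coordinates are regular functions (any `ι : Y ⟶ ℙⁿ⁺¹_ℂ`)**: for `P` over `ι⁻¹(Uᵢ)`, the value at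
`P` of `ι^*(X_{i.succAbove j}/Xᵢ)` is the `j`-th coordinate of `hypersurfacePoint ι P` in the `i`-th standard chart
(the proof of `evalOrZero_hypersurfaceCoordFn`, which is the case of a closed immersion).
[cite: SerreGAGA1956, §2 n°5 Lemme 1 c) and Prop. 2] -/
theorem evalOrZero_app_projRatioSection (j : Fin (n + 1)) (P : Motives.ComplexPoints Y)
    (hP : P.pt ∈ ι.left ⁻¹ᵁ projChartOpen i) :
    Motives.AlgPoints.evalOrZero (ι.left ⁻¹ᵁ projChartOpen i)
        (ι.left.app (projChartOpen i) (projRatioSection i (i.succAbove j))) P =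
      Projectivization.stdChart i (hypersurfacePoint ι P) j := by
  have hsrc : hypersurfacePoint ι P ∈ (Projectivization.stdChart i).source :=
    (pt_map_mem_projChartOpen_iff ι i P).mp hP
  set v := (hypersurfacePoint ι P).rep with hv
  have hv0 : v ≠ 0 := (hypersurfacePoint ι P).rep_nonzero
  have hmk : Projectivization.mk ℂ v hv0 = hypersurfacePoint ι P := Projectivization.mk_rep _
  have hvi : v i ≠ 0 := by
    rw [← hmk, Projectivization.stdChart_source, Projectivization.mk_mem_stdChartSource_iff] at hsrc
    exact hsrc
  have hmap : Motives.AlgPoints.map ι P =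
      Motives.AlgPoints.map (chartι (n + 1) i) (chartPoint (n + 1) v hvi) := by
    rw [← projPoint_hypersurfacePoint, ← hmk]
    exact projPoint_mk_eq_map_chartPoint (n + 1) v hvi
  rw [Motives.AlgPoints.evalOrZero_of_mem _ hP]
  have hP' : (Motives.AlgPoints.map ι P).pt ∈ projChartOpen i := hP
  have step1 : P.eval (ι.left ⁻¹ᵁ projChartOpen i) hP (ι.left.app (projChartOpen i) (projRatioSection i (i.succAbove j))) =
      (Motives.AlgPoints.map ι P).eval (projChartOpen i) hP' (projRatioSection i (i.succAbove j)) :=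
    (Motives.AlgPoints.eval_map ι P (projChartOpen i) hP' _).symm
  have h' : (Motives.AlgPoints.map (chartι (n + 1) i) (chartPoint (n + 1) v hvi)).pt ∈
      projChartOpen i := by
    rw [← hmap]; exact hP'
  have step2 : (Motives.AlgPoints.map ι P).eval (projChartOpen i) hP'
      (projRatioSection i (i.succAbove j)) =
      (Motives.AlgPoints.map (chartι (n + 1) i) (chartPoint (n + 1) v hvi)).eval (projChartOpen i) h'
        (projRatioSection i (i.succAbove j)) := by
    congr 1
  rw [step1, step2, eval_projRatioSection_map_chartPoint, ← hmk, Projectivization.stdChart_apply,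
    Projectivization.stdChartFun_mk]

end Literature.AlgebraicGeometry.HodgeTheory

end
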